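import Mathlib
import HarnessLib
import Summits.HubbardSuperconductivity.HubbardSuperconductivity.Theorems.KLProgrammeC4aLoopAlignment
import Summits.HubbardSuperconductivity.HubbardSuperconductivity.Theorems.KLProgrammePerturbedFermiCurveCausticHessian
import Summits.HubbardSuperconductivity.HubbardSuperconductivity.Theorems.KLProgrammeFermiSeaConvex

/-!
# Route `KLProgramme` — crux C4a, S3 brick (B2-trans)(b) GEOMETRY, part 4: the CHORD-MIDPOINT LEVEL DEPTH of the Fermi sea (GLOBAL strict convexity in level form,
# free band EXACT by the identity `cos a·cos b = cos²((a+b)/2) − sin²((a−b)/2)`; frame with an `O(A + |ρ|)` slack) and the TANGENCY-BRANCH conversion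
# `‖S − 2Φ(0,χ)‖ ≤ ε ⇒ ‖ϑ‖_𝕋² ≲ A + |ρ| + Kc·ε`, `‖χ − θ‖_𝕋 ≲ ε + ‖ϑ‖_𝕋`

Cell `gate-hubbard-kl`, seat hubbard-kl-k3c3-p3 g19 (row «implicit-function / monotonicity route for μ(n)»); helper for stub (C) `stub_twoLeg_curvature` of
`KLRegimeEngineV17F2` (stmt-HubbardSuperconductivity-20437), lane hubbard-kl-c4a-1's S3 plan §24.10 (B2-trans)(b) («… a global statement on the circle needs the
convexity of FS»); this row's located note HOME/hubbard-kl-k3c3-p3/B2TRANS-UMKLAPP.md §3 L4/L5.  CONTENT: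
* §1 `cos_mul_cos_eq_sq_sub_sq` (`cos a cos b = cos²((a+b)/2) − sin²((a−b)/2)`), `mul_le_cos_sq_half_sum` (`cos a cos b·(1 + sin²((a−b)/2)) ≤ cos²((a+b)/2)`,
  since `cos a cos b ≤ 1`), `sq_div_pi_sq_le_sin_sq_half` (Jordan `(z/π)² ≤ sin²(z/2)` on `|z| ≤ π`);
* §2 **`halfCosSum_midpoint_ge`** — for two points `k₁, k₂` of the open diamond `{|x ± y| < π}` with `m ≤ (cos x_i + cos y_i)/2`, `0 ≤ m`:
  `(cos x_M + cos y_M)/2 ≥ m·(1 + ((Δx)² + (Δy)²)/(6π²))` at the midpoint — the free Fermi sea is UNIFORMLY convex in LEVEL form on the whole hole-doped band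
  (via `cos x + cos y = 2cos u cos v`, `u, v = (x ± y)/2`, and §1 in `u` and in `v`); **`sqDispersion_midpoint_le`** (`ε₀(M) ≤ −4m(1 + ‖Δ‖²/(6π²))`);
* §3 **`frameLevel_midpoint_pairSum_le`** — for the chart points `A = Φ(0,θ)`, `B = Φ(ρ,ϑ+θ)` of an admissible frame (`|δ_K| ≤ A`):
  `e_K(S/2) ≤ 2A + |ρ| − ((|μ| − A − |ρ|)/(6π²))·‖A − B‖²`, `S = A + B = S_{ρ,ϑ,θ}(0)`;
* §4 **`norm_chord_sq_le_of_midpoint_near`**, **`torusDist_sq_le_of_midpoint_near`**, **`torusDist_le_of_midpoint_near`** — if `‖S − 2Φ(0,χ)‖ ≤ ε` then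
  (`e_K` is `Kc`-Lipschitz, `GeomConstants`) `‖A − B‖² ≤ 6π²(2A + |ρ| + Kc·ε/2)/(|μ| − A − |ρ|)`, `‖ϑ‖_𝕋 ≤ (π/(2u_min))‖A − B‖`, `‖χ − θ‖_𝕋 ≤ (π/(4u_min))(ε + ‖A − B‖)`;
(The assembly with part 3's dichotomy — `loop_nondegeneracy_directSheet` — is part 5, `…C4aLoopNondegeneracy`.)
Everything proved on landed objects; nothing about the model's sizes; nothing asserts superconductivity.
References: FST II CPAM 51 (1998) §3 (strict convexity (H3)) [cite: FeldmanSalmhoferTrubowitz1998]; BGM 2003 §7.1 Lemma 7.1 [cite: BenfattoGiulianiMastropietro2003];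
BGM 2006 §2.4 (2.40), App. A2 [cite: BenfattoGiulianiMastropietro2006].
-/

noncomputable section

namespace Summit.HubbardSuperconductivity.HubbardSuperconductivity.Theorems.C4a

set_option linter.dupNamespace false -- summit = problem name (single-conjunct summit), D-0017

open Real Set
open Literature.MathematicalPhysics.QuantumLattice Literature.MathematicalPhysics.QuantumLattice.BandSectorCounting
open Literature.MathematicalPhysics.QuantumLattice.FermiRG
open Summit.HubbardSuperconductivity.HubbardSuperconductivity.Theorems.KLRegimeSplit
open Summit.HubbardSuperconductivity.HubbardSuperconductivity.Theorems.DispersionFlow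
open Summit.HubbardSuperconductivity.HubbardSuperconductivity.Theorems.PerturbedFermiCurve

/-! ## §1 One-variable trigonometry -/

/-- `cos a·cos b = cos²((a+b)/2) − sin²((a−b)/2)`. -/
theorem cos_mul_cos_eq_sq_sub_sq (a b : ℝ) : Real.cos a * Real.cos b = Real.cos ((a + b) / 2) ^ 2 - Real.sin ((a - b) / 2) ^ 2 := by
  have h : Real.cos a * Real.cos b = Real.cos ((a + b) / 2 + (a - b) / 2) * Real.cos ((a + b) / 2 - (a - b) / 2) := by
    rw [show (a + b) / 2 + (a - b) / 2 = a by ring, show (a + b) / 2 - (a - b) / 2 = b by ring]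
  rw [h, Real.cos_add, Real.cos_sub]
  have h1 := Real.sin_sq_add_cos_sq ((a + b) / 2)
  have h2 := Real.sin_sq_add_cos_sq ((a - b) / 2)
  linear_combination (Real.cos ((a + b) / 2)) ^ 2 * h2 - (Real.sin ((a - b) / 2)) ^ 2 * h1

/-- **Midpoint gain**: `cos a·cos b·(1 + sin²((a−b)/2)) ≤ cos²((a+b)/2)` (as `cos a·cos b ≤ 1`). -/
theorem mul_le_cos_sq_half_sum (a b : ℝ) :
    Real.cos a * Real.cos b * (1 + Real.sin ((a - b) / 2) ^ 2) ≤ Real.cos ((a + b) / 2) ^ 2 := by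
  have hid := cos_mul_cos_eq_sq_sub_sq a b
  have h1 : Real.cos a * Real.cos b ≤ 1 := by
    have ha := Real.abs_cos_le_one a
    have hb := Real.abs_cos_le_one b
    have h : |Real.cos a * Real.cos b| ≤ 1 := by rw [abs_mul]; exact mul_le_one₀ ha (abs_nonneg _) hb
    exact (le_abs_self _).trans h
  have hkey := mul_nonneg (sub_nonneg.2 h1) (sq_nonneg (Real.sin ((a - b) / 2)))
  nlinarith [hid, hkey]

/-- **Jordan, squared**: `(z/π)² ≤ sin²(z/2)` for `|z| ≤ π`. -/
theorem sq_div_pi_sq_le_sin_sq_half {z : ℝ} (hz : |z| ≤ π) : (z / π) ^ 2 ≤ Real.sin (z / 2) ^ 2 := by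
  have hπ := Real.pi_pos
  -- `|sin(z/2)| ≥ (2/π)|z/2| = |z|/π`
  have key : |z| / π ≤ |Real.sin (z / 2)| := by
    have hj : ∀ y : ℝ, 0 ≤ y → y ≤ π / 2 → 2 / π * y ≤ Real.sin y := fun y h0 h1 => Real.mul_le_sin h0 h1
    rcases le_or_gt 0 z with h0 | h0
    · have h := hj (z / 2) (by linarith) (by linarith [(abs_le.1 hz).2])
      rw [abs_of_nonneg h0, abs_of_nonneg (by
        exact Real.sin_nonneg_of_nonneg_of_le_pi (by linarith) (by linarith [(abs_le.1 hz).2]))]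
      calc z / π = 2 / π * (z / 2) := by ring
        _ ≤ Real.sin (z / 2) := h
    · have h := hj (-z / 2) (by linarith) (by linarith [(abs_le.1 hz).1])
      have e : Real.sin (-z / 2) = -Real.sin (z / 2) := by rw [show -z / 2 = -(z / 2) by ring, Real.sin_neg]
      rw [e] at h
      have hnn : 0 ≤ 2 / π * (-z / 2) := mul_nonneg (by positivity) (by linarith)
      rw [abs_of_neg h0, abs_of_nonpos (by linarith)]
      calc -z / π = 2 / π * (-z / 2) := by ring
        _ ≤ -Real.sin (z / 2) := h
  have h0 : 0 ≤ |z| / π := by positivity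
  calc (z / π) ^ 2 = (|z| / π) ^ 2 := by rw [div_pow, div_pow, sq_abs]
    _ ≤ |Real.sin (z / 2)| ^ 2 := pow_le_pow_left₀ h0 key 2
    _ = Real.sin (z / 2) ^ 2 := sq_abs _

/-! ## §2 The free Fermi sea is uniformly convex in level form: the midpoint gain for `(cos x + cos y)/2` -/

/-- `(cos x + cos y)/2 = cos((x+y)/2)·cos((x−y)/2)`. -/
theorem halfCosSum_eq (x y : ℝ) : (Real.cos x + Real.cos y) / 2 = Real.cos ((x + y) / 2) * Real.cos ((x - y) / 2) := by
  rw [Real.cos_add_cos]; ring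

/-- **MIDPOINT GAIN of `(cos x + cos y)/2` on the diamond** `{|x + y| < π, |x − y| < π}`: for two points with `m ≤ (cos x_i + cos y_i)/2` (`0 ≤ m`), at the midpoint
`(cos x_M + cos y_M)/2 ≥ m·(1 + ((x₁−x₂)² + (y₁−y₂)²)/(6π²))` — uniform convexity of the free Fermi sea `{cos x + cos y > −μ/2}` in LEVEL form, on the whole
hole-doped band. [cite: FeldmanSalmhoferTrubowitz1998, §3 (H3)] -/
theorem halfCosSum_midpoint_ge {x₁ y₁ x₂ y₂ m : ℝ} (hm : 0 ≤ m) (h₁ : m ≤ (Real.cos x₁ + Real.cos y₁) / 2) (h₂ : m ≤ (Real.cos x₂ + Real.cos y₂) / 2)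
    (hd₁ : |x₁ + y₁| < π) (hd₁' : |x₁ - y₁| < π) (hd₂ : |x₂ + y₂| < π) (hd₂' : |x₂ - y₂| < π) :
    m * (1 + ((x₁ - x₂) ^ 2 + (y₁ - y₂) ^ 2) / (6 * π ^ 2)) ≤
      (Real.cos ((x₁ + x₂) / 2) + Real.cos ((y₁ + y₂) / 2)) / 2 := by
  have hπ := Real.pi_pos
  -- diamond coordinates
  set u₁ := (x₁ + y₁) / 2 with hu₁
  set v₁ := (x₁ - y₁) / 2 with hv₁
  set u₂ := (x₂ + y₂) / 2 with hu₂
  set v₂ := (x₂ - y₂) / 2 with hv₂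
  have hu₁a : |u₁| < π / 2 := by rw [hu₁, abs_div, abs_two]; linarith
  have hv₁a : |v₁| < π / 2 := by rw [hv₁, abs_div, abs_two]; linarith
  have hu₂a : |u₂| < π / 2 := by rw [hu₂, abs_div, abs_two]; linarith
  have hv₂a : |v₂| < π / 2 := by rw [hv₂, abs_div, abs_two]; linarith
  have hcos_pos : ∀ t : ℝ, |t| < π / 2 → 0 < Real.cos t := fun t ht =>
    Real.cos_pos_of_mem_Ioo ⟨by linarith [(abs_lt.1 ht).1], (abs_lt.1 ht).2⟩
  have hcu₁ := hcos_pos u₁ hu₁a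
  have hcv₁ := hcos_pos v₁ hv₁a
  have hcu₂ := hcos_pos u₂ hu₂a
  have hcv₂ := hcos_pos v₂ hv₂a
  have hP₁ : (Real.cos x₁ + Real.cos y₁) / 2 = Real.cos u₁ * Real.cos v₁ := halfCosSum_eq x₁ y₁
  have hP₂ : (Real.cos x₂ + Real.cos y₂) / 2 = Real.cos u₂ * Real.cos v₂ := halfCosSum_eq x₂ y₂
  have hPM : (Real.cos ((x₁ + x₂) / 2) + Real.cos ((y₁ + y₂) / 2)) / 2 = Real.cos ((u₁ + u₂) / 2) * Real.cos ((v₁ + v₂) / 2) := by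
    rw [halfCosSum_eq, show ((x₁ + x₂) / 2 + (y₁ + y₂) / 2) / 2 = (u₁ + u₂) / 2 by rw [hu₁, hu₂]; ring,
      show ((x₁ + x₂) / 2 - (y₁ + y₂) / 2) / 2 = (v₁ + v₂) / 2 by rw [hv₁, hv₂]; ring]
  rw [hP₁] at h₁; rw [hP₂] at h₂
  -- midpoint gains in `u` and in `v`
  have gu := mul_le_cos_sq_half_sum u₁ u₂
  have gv := mul_le_cos_sq_half_sum v₁ v₂
  set su := Real.sin ((u₁ - u₂) / 2) ^ 2 with hsu
  set sv := Real.sin ((v₁ - v₂) / 2) ^ 2 with hsv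
  set cM := Real.cos ((u₁ + u₂) / 2) with hcM
  set dM := Real.cos ((v₁ + v₂) / 2) with hdM
  have hcMpos : 0 < cM := hcos_pos _ (by
    rw [abs_div, abs_two]; have := abs_add_le u₁ u₂; linarith)
  have hdMpos : 0 < dM := hcos_pos _ (by
    rw [abs_div, abs_two]; have := abs_add_le v₁ v₂; linarith)
  -- product: `(cM·dM)² ≥ P₁P₂(1+su)(1+sv) ≥ m²(1 + su + sv)`
  have hsu0 : 0 ≤ su := sq_nonneg _
  have hsv0 : 0 ≤ sv := sq_nonneg _
  have hsu1 : su ≤ 1 := by rw [hsu]; exact Real.sin_sq_le_one _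
  have hsv1 : sv ≤ 1 := by rw [hsv]; exact Real.sin_sq_le_one _
  have hP1pos : 0 < Real.cos u₁ * Real.cos v₁ := mul_pos hcu₁ hcv₁
  have hP2pos : 0 < Real.cos u₂ * Real.cos v₂ := mul_pos hcu₂ hcv₂
  have step1 : (Real.cos u₁ * Real.cos v₁) * (Real.cos u₂ * Real.cos v₂) * ((1 + su) * (1 + sv)) ≤ cM ^ 2 * dM ^ 2 := by
    have e := mul_le_mul gu gv (by positivity) (sq_nonneg _)
    calc _ = Real.cos u₁ * Real.cos u₂ * (1 + su) * (Real.cos v₁ * Real.cos v₂ * (1 + sv)) := by ring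
      _ ≤ cM ^ 2 * dM ^ 2 := e
  have step2 : m ^ 2 ≤ (Real.cos u₁ * Real.cos v₁) * (Real.cos u₂ * Real.cos v₂) := by
    rw [sq]; exact mul_le_mul h₁ h₂ hm hP1pos.le
  set σ := su + sv with hσ
  have hσ0 : 0 ≤ σ := by rw [hσ]; positivity
  have hσ3 : σ ≤ 3 := by rw [hσ]; linarith
  have step3 : m ^ 2 * (1 + σ) ≤ cM ^ 2 * dM ^ 2 := by
    have hX : 1 + σ ≤ (1 + su) * (1 + sv) := by
      have e : (1 + su) * (1 + sv) = 1 + (su + sv) + su * sv := by ring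
      rw [e, hσ]; linarith [mul_nonneg hsu0 hsv0]
    calc m ^ 2 * (1 + σ) ≤ m ^ 2 * ((1 + su) * (1 + sv)) := mul_le_mul_of_nonneg_left hX (sq_nonneg m)
      _ ≤ (Real.cos u₁ * Real.cos v₁) * (Real.cos u₂ * Real.cos v₂) * ((1 + su) * (1 + sv)) :=
          mul_le_mul_of_nonneg_right step2 (by positivity)
      _ ≤ cM ^ 2 * dM ^ 2 := step1
  have step4 : (m * (1 + σ / 3)) ^ 2 ≤ (cM * dM) ^ 2 := by
    have h13 : (1 + σ / 3) ^ 2 ≤ 1 + σ := by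
      have hnn : 0 ≤ σ * (3 - σ) / 9 := div_nonneg (mul_nonneg hσ0 (by linarith)) (by norm_num)
      calc (1 + σ / 3) ^ 2 = 1 + σ - σ * (3 - σ) / 9 := by ring
        _ ≤ 1 + σ := by linarith
    calc (m * (1 + σ / 3)) ^ 2 = m ^ 2 * (1 + σ / 3) ^ 2 := by ring
      _ ≤ m ^ 2 * (1 + σ) := mul_le_mul_of_nonneg_left h13 (sq_nonneg m)
      _ ≤ cM ^ 2 * dM ^ 2 := step3
      _ = (cM * dM) ^ 2 := by ring
  have step5 : m * (1 + σ / 3) ≤ cM * dM :=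
    (pow_le_pow_iff_left₀ (by positivity) (mul_pos hcMpos hdMpos).le two_ne_zero).1 step4
  -- Jordan in `u` and `v`, and `(Δu)² + (Δv)² = ((Δx)² + (Δy)²)/2`
  have hdu : |u₁ - u₂| ≤ π := by have := abs_sub u₁ u₂; linarith
  have hdv : |v₁ - v₂| ≤ π := by have := abs_sub v₁ v₂; linarith
  have ju := sq_div_pi_sq_le_sin_sq_half hdu
  have jv := sq_div_pi_sq_le_sin_sq_half hdv
  have hgeom : ((x₁ - x₂) ^ 2 + (y₁ - y₂) ^ 2) / (6 * π ^ 2) ≤ σ / 3 := by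
    have e1 : ((u₁ - u₂) / π) ^ 2 + ((v₁ - v₂) / π) ^ 2 = ((x₁ - x₂) ^ 2 + (y₁ - y₂) ^ 2) / (2 * π ^ 2) := by
      rw [hu₁, hu₂, hv₁, hv₂]; field_simp; ring
    have e2 : ((x₁ - x₂) ^ 2 + (y₁ - y₂) ^ 2) / (2 * π ^ 2) ≤ σ := by rw [← e1, hσ, hsu, hsv]; exact add_le_add ju jv
    have e3 : ((x₁ - x₂) ^ 2 + (y₁ - y₂) ^ 2) / (6 * π ^ 2) = ((x₁ - x₂) ^ 2 + (y₁ - y₂) ^ 2) / (2 * π ^ 2) / 3 := by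
      field_simp; ring
    rw [e3]; linarith
  rw [hPM]
  calc m * (1 + ((x₁ - x₂) ^ 2 + (y₁ - y₂) ^ 2) / (6 * π ^ 2)) ≤ m * (1 + σ / 3) := mul_le_mul_of_nonneg_left (by linarith) hm
    _ ≤ cM * dM := step5

/-- **Midpoint level depth of the FREE dispersion**: under the hypotheses of `halfCosSum_midpoint_ge` for `k₁, k₂ : Fin 2 → ℝ`,
`ε₀((k₁+k₂)/2) ≤ −4m·(1 + ((k₁−k₂)₀² + (k₁−k₂)₁²)/(6π²))` (`ε₀ = −2(cos k₀ + cos k₁)`, so `ε₀(k_i) ≤ −4m`). [cite: FeldmanSalmhoferTrubowitz1998, §3 (H3)] -/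
theorem sqDispersion_midpoint_le {k₁ k₂ : Fin 2 → ℝ} {m : ℝ} (hm : 0 ≤ m) (h₁ : m ≤ (Real.cos (k₁ 0) + Real.cos (k₁ 1)) / 2)
    (h₂ : m ≤ (Real.cos (k₂ 0) + Real.cos (k₂ 1)) / 2) (hd₁ : |k₁ 0 + k₁ 1| < π) (hd₁' : |k₁ 0 - k₁ 1| < π) (hd₂ : |k₂ 0 + k₂ 1| < π)
    (hd₂' : |k₂ 0 - k₂ 1| < π) :
    sqDispersion ((1 / 2 : ℝ) • (k₁ + k₂)) ≤ -(4 * m) * (1 + ((k₁ 0 - k₂ 0) ^ 2 + (k₁ 1 - k₂ 1) ^ 2) / (6 * π ^ 2)) := by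
  have h := halfCosSum_midpoint_ge hm h₁ h₂ hd₁ hd₁' hd₂ hd₂'
  have e0 : ((1 / 2 : ℝ) • (k₁ + k₂)) 0 = (k₁ 0 + k₂ 0) / 2 := by simp [Pi.smul_apply]; ring
  have e1 : ((1 / 2 : ℝ) • (k₁ + k₂)) 1 = (k₁ 1 + k₂ 1) / 2 := by simp [Pi.smul_apply]; ring
  simp only [sqDispersion, e0, e1]
  linarith

/-! ## §3 The frame: level depth of the midpoint of the chord `[Φ(0,θ), Φ(ρ,ϑ+θ)]` -/

section Band

variable {a b : ℝ} (B : BandBounds a b) {K : TrigPolyC4v} {A : ℝ} (hA : ∀ p : Momentum, ∀ j ≤ 2, ‖iteratedFDeriv ℝ j (frameShift K) p‖ ≤ A)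
  {μ : ℝ}
include B hA

/-- A chart point lies in the closed square, and its free level is `μ + ρ + K(Φ)`: `ε₀(Φ(ρ,s)) = μ + ρ − δ_K(Φ(ρ,s))` with `|δ_K| ≤ A`. -/
theorem sqDispersion_levelPoint_eq {ρ : ℝ} (hlo : a ≤ μ + ρ - A) (hhi : μ + ρ + A ≤ b) (s : ℝ) :
    sqDispersion (WithLp.ofLp (levelPoint μ K ρ s)) = μ + ρ - frameShift K (levelPoint μ K ρ s) ∧
      (∀ i, |(WithLp.ofLp (levelPoint μ K ρ s)) i| ≤ π) := by
  have hδc : Continuous (fun k : Fin 2 → ℝ => -K.eval k) := by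
    rw [← frameShift_toLp_eq_neg_eval]; exact continuous_frameShift_toLp K
  have hδ : ∀ k : Fin 2 → ℝ, (∀ i, |k i| ≤ π) → |(fun p : Fin 2 → ℝ => -K.eval p) k| ≤ A := fun k _ => by
    simpa [frameShift_toLp] using abs_frameShift_toLp_le hA k
  have hu := isBandFermiRadius_perturbedFermiRadius B hδc hδ hlo hhi s
  refine ⟨?_, fun i => ?_⟩
  · have hroot := ((isBandFermiRadius_shifted_iff (fun k : Fin 2 → ℝ => -K.eval k) (μ + ρ) s _).1 hu).2
    -- `hroot : ε₀(u•dir s) + δ_K(u•dir s) = μ + ρ`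
    have e1 : WithLp.ofLp (levelPoint μ K ρ s) = perturbedFermiRadius (fun k : Fin 2 → ℝ => -K.eval k) (μ + ρ) s • dir s := rfl
    have e2 : frameShift K (levelPoint μ K ρ s) =
        (fun k : Fin 2 → ℝ => -K.eval k) (perturbedFermiRadius (fun k : Fin 2 → ℝ => -K.eval k) (μ + ρ) s • dir s) := by
      rw [levelPoint_eq_toLp_smul_dir, frameShift_toLp]
    rw [e1, e2]; linarith
  · exact abs_apply_le_pi_of_isBandFermiRadius hu i

omit B hA in
/-- `‖v‖² = v₀² + v₁²` on `Momentum`. -/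
theorem norm_sq_eq_add_sq (v : Momentum) : ‖v‖ ^ 2 = (v 0) ^ 2 + (v 1) ^ 2 := by
  rw [EuclideanSpace.norm_eq, Real.sq_sqrt (Finset.sum_nonneg fun i _ => sq_nonneg _), Fin.sum_univ_two, Real.norm_eq_abs,
    Real.norm_eq_abs, sq_abs, sq_abs]

/-- **LEVEL DEPTH OF THE CHORD MIDPOINT (frame)**: for the chart points `A = Φ(0,θ)` (level `0`) and `B = Φ(ρ,ϑ+θ)` (level `ρ`) of an admissible frame
(`|δ_K| ≤ A`, both free levels in `[a, b] ⊂ (−4, 0)`, `μ + A + |ρ| ≤ 0`), the frame band at the midpoint `S/2 = (A + B)/2` satisfies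
`e_K(S/2) ≤ 2A + |ρ| − ((−μ − A − |ρ|)/(6π²))·‖A − B‖²` — uniform convexity of the Fermi sea in level form, up to the frame's `O(A)` and the leg level.
[cite: FeldmanSalmhoferTrubowitz1998, §3 (H3)] -/
theorem frameLevel_midpoint_pairSum_le {ρ : ℝ} (hlo₀ : a ≤ μ + 0 - A) (hhi₀ : μ + 0 + A ≤ b) (hlo : a ≤ μ + ρ - A) (hhi : μ + ρ + A ≤ b)
    (hneg : μ + A + |ρ| ≤ 0) (ϑ θ : ℝ) :
    frameLevel μ K ((1 / 2 : ℝ) • (levelPoint μ K 0 θ + levelPoint μ K ρ (ϑ + θ))) ≤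
      2 * A + |ρ| - (-μ - A - |ρ|) / (6 * π ^ 2) * ‖levelPoint μ K 0 θ - levelPoint μ K ρ (ϑ + θ)‖ ^ 2 := by
  set P := levelPoint μ K 0 θ with hPdef
  set Q := levelPoint μ K ρ (ϑ + θ) with hQdef
  obtain ⟨hε₁, hsq₁⟩ := sqDispersion_levelPoint_eq B hA hlo₀ hhi₀ θ
  obtain ⟨hε₂, hsq₂⟩ := sqDispersion_levelPoint_eq B hA hlo hhi (ϑ + θ)
  rw [← hPdef] at hε₁ hsq₁; rw [← hQdef] at hε₂ hsq₂
  have hfs₁ : |frameShift K P| ≤ A := by rw [hPdef, levelPoint_eq_toLp_smul_dir]; exact abs_frameShift_toLp_le hA _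
  have hfs₂ : |frameShift K Q| ≤ A := by rw [hQdef, levelPoint_eq_toLp_smul_dir]; exact abs_frameShift_toLp_le hA _
  set k₁ : Fin 2 → ℝ := WithLp.ofLp P with hk₁
  set k₂ : Fin 2 → ℝ := WithLp.ofLp Q with hk₂
  set M : Momentum := (1 / 2 : ℝ) • (P + Q) with hMdef
  have hMk : WithLp.ofLp M = (1 / 2 : ℝ) • (k₁ + k₂) := by simp [hMdef, hk₁, hk₂]
  have hfsM : |frameShift K M| ≤ A := by
    have := abs_frameShift_toLp_le hA (WithLp.ofLp M); simpa using this
  -- the free half-cos-sums at the two chart points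
  set m := (-μ - A - |ρ|) / 4 with hmdef
  have hm : 0 ≤ m := by rw [hmdef]; linarith
  have hcos₁ : (Real.cos (k₁ 0) + Real.cos (k₁ 1)) / 2 = -(sqDispersion k₁) / 4 := by simp only [sqDispersion]; ring
  have hcos₂ : (Real.cos (k₂ 0) + Real.cos (k₂ 1)) / 2 = -(sqDispersion k₂) / 4 := by simp only [sqDispersion]; ring
  have h₁ : m ≤ (Real.cos (k₁ 0) + Real.cos (k₁ 1)) / 2 := by
    rw [hcos₁, hε₁, hmdef]; have := (abs_le.1 hfs₁).1; have := abs_nonneg ρ; linarith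
  have h₂ : m ≤ (Real.cos (k₂ 0) + Real.cos (k₂ 1)) / 2 := by
    rw [hcos₂, hε₂, hmdef]; have := (abs_le.1 hfs₂).1; have := le_abs_self ρ; linarith
  -- both points lie in the open diamond
  have hb0 : b < 0 := B.hb
  have hpos₁ : 0 < Real.cos (k₁ 0) + Real.cos (k₁ 1) := by
    have e : Real.cos (k₁ 0) + Real.cos (k₁ 1) = -(sqDispersion k₁) / 2 := by simp only [sqDispersion]; ring
    rw [e, hε₁]; have := (abs_le.1 hfs₁).1; linarith
  have hpos₂ : 0 < Real.cos (k₂ 0) + Real.cos (k₂ 1) := by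
    have e : Real.cos (k₂ 0) + Real.cos (k₂ 1) = -(sqDispersion k₂) / 2 := by simp only [sqDispersion]; ring
    rw [e, hε₂]; have := (abs_le.1 hfs₂).1; have := le_abs_self ρ; linarith
  have hdia₁ := abs_add_abs_lt_pi_of_cos_add_cos_pos (hsq₁ 0) (hsq₁ 1) hpos₁
  have hdia₂ := abs_add_abs_lt_pi_of_cos_add_cos_pos (hsq₂ 0) (hsq₂ 1) hpos₂
  have hd₁ : |k₁ 0 + k₁ 1| < π := (abs_add_le _ _).trans_lt hdia₁
  have hd₁' : |k₁ 0 - k₁ 1| < π := (abs_sub _ _).trans_lt hdia₁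
  have hd₂ : |k₂ 0 + k₂ 1| < π := (abs_add_le _ _).trans_lt hdia₂
  have hd₂' : |k₂ 0 - k₂ 1| < π := (abs_sub _ _).trans_lt hdia₂
  have hmid := sqDispersion_midpoint_le hm h₁ h₂ hd₁ hd₁' hd₂ hd₂'
  -- the distance
  have hdist : (k₁ 0 - k₂ 0) ^ 2 + (k₁ 1 - k₂ 1) ^ 2 = ‖P - Q‖ ^ 2 := by
    rw [norm_sq_eq_add_sq]; simp [hk₁, hk₂]
  -- assemble
  have hM : frameLevel μ K M = sqDispersion (WithLp.ofLp M) + frameShift K M - μ := by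
    have := frameLevel_toLp μ K (WithLp.ofLp M); simpa using this
  rw [hM, hMk]
  rw [hdist] at hmid
  have hfsM' := (abs_le.1 hfsM).2
  have e : -(4 * m) = μ + A + |ρ| := by rw [hmdef]; ring
  rw [e] at hmid
  have : (μ + A + |ρ|) * (1 + ‖P - Q‖ ^ 2 / (6 * π ^ 2)) = (μ + A + |ρ|) - (-μ - A - |ρ|) / (6 * π ^ 2) * ‖P - Q‖ ^ 2 := by ring
  rw [this] at hmid
  have hofLp : frameShift K M ≤ A := (le_abs_self _).trans hfsM
  have hsame : sqDispersion ((1 / 2 : ℝ) • (k₁ + k₂)) = sqDispersion (WithLp.ofLp M) := by rw [hMk]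
  linarith

end Band

/-! ## §4 The tangency branch: from «midpoint near the curve» to «short chord», `‖ϑ‖_𝕋` and `‖χ − θ‖_𝕋` small -/

section Sizes

variable {K : TrigPolyC4v} {A : ℝ} (hA : ∀ p : Momentum, ∀ j ≤ 2, ‖iteratedFDeriv ℝ j (frameShift K) p‖ ≤ A) (hA20 : A ≤ 1 / 20)
  (hd : klCurveD ≤ (bandBounds (show (-4 : ℝ) < -1.1 by norm_num) (show (-1.1 : ℝ) ≤ -0.1 by norm_num)
    (show (-0.1 : ℝ) < 0 by norm_num)).Dtmin - 2 * A)
  {μ r : ℝ} (hr : 0 < r) (hlo : (-1.1 : ℝ) < μ - r - A) (hhi : μ + r + A < -0.1)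
  {A₃ A₄ : ℝ} (hA₃ : ∀ p : Momentum, ‖iteratedFDeriv ℝ 3 (frameShift K) p‖ ≤ A₃)
  (hA₄ : ∀ p : Momentum, ‖iteratedFDeriv ℝ 4 (frameShift K) p‖ ≤ A₄)
include hA hA20 hd hr hlo hhi hA₃ hA₄

omit hA20 hd hA₃ hA₄ in
/-- **Short chord from a near-curve midpoint**: if `‖S − 2Φ(0,χ)‖ ≤ ε` (`S = Φ(0,θ) + Φ(ρ,ϑ+θ)`, `|ρ| < r`) then, `e_K` being `Kc`-Lipschitz under
`GeomConstants (frameLevel μ K) Kc r₀ g₀ w`, `‖Φ(0,θ) − Φ(ρ,ϑ+θ)‖² ≤ 6π²·(2A + |ρ| + Kc·ε/2)/(−μ − A − |ρ|)`. [cite: FeldmanSalmhoferTrubowitz1998, §3 (H3)] -/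
theorem norm_chord_sq_le_of_midpoint_near {Kc r₀ g₀ w : ℝ} (hG : GeomConstants (frameLevel μ K) Kc r₀ g₀ w) {ρ : ℝ} (hρ : |ρ| < r) {ϑ θ χ ε : ℝ}
    (hε : ‖pairSumPath μ K ρ ϑ θ 0 - (2 : ℝ) • levelPoint μ K 0 χ‖ ≤ ε) :
    ‖levelPoint μ K 0 θ - levelPoint μ K ρ (ϑ + θ)‖ ^ 2 ≤ 6 * π ^ 2 * (2 * A + |ρ| + Kc * ε / 2) / (-μ - A - |ρ|) := by
  set B := bandBounds (show (-4 : ℝ) < -1.1 by norm_num) (show (-1.1 : ℝ) ≤ -0.1 by norm_num) (show (-0.1 : ℝ) < 0 by norm_num) with hBdef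
  have hρ1 := (abs_lt.1 hρ).1; have hρ2 := (abs_lt.1 hρ).2
  have hρabs : |ρ| < r := hρ
  have hlo₀ : (-1.1 : ℝ) ≤ μ + 0 - A := by linarith
  have hhi₀ : μ + 0 + A ≤ -0.1 := by linarith
  have hloρ : (-1.1 : ℝ) ≤ μ + ρ - A := by linarith
  have hhiρ : μ + ρ + A ≤ -0.1 := by linarith
  have hneg : μ + A + |ρ| ≤ 0 := by linarith
  have hgap : 0 < -μ - A - |ρ| := by linarith
  have hdepth := frameLevel_midpoint_pairSum_le B hA hlo₀ hhi₀ hloρ hhiρ hneg ϑ θ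
  -- Lipschitz from the curve point `Φ(0,χ)` (`e_K = 0` there)
  have hzero : frameLevel μ K (levelPoint μ K 0 χ) = 0 := frameLevel_levelPoint_zero B hA hr hlo hhi χ
  have hS : pairSumPath μ K ρ ϑ θ 0 = levelPoint μ K 0 θ + levelPoint μ K ρ (ϑ + θ) := by simp only [pairSumPath, add_zero]
  set M : Momentum := (1 / 2 : ℝ) • (levelPoint μ K 0 θ + levelPoint μ K ρ (ϑ + θ)) with hMdef
  have hMQ : ‖M - levelPoint μ K 0 χ‖ ≤ ε / 2 := by
    have e : M - levelPoint μ K 0 χ = (1 / 2 : ℝ) • (pairSumPath μ K ρ ϑ θ 0 - (2 : ℝ) • levelPoint μ K 0 χ) := by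
      rw [hMdef, hS]; module
    rw [e, norm_smul, Real.norm_eq_abs, abs_of_pos (by norm_num : (0 : ℝ) < 1 / 2)]
    linarith
  have hlip := PerturbedFermiCurve.abs_frameLevel_sub_le hG (levelPoint μ K 0 χ) M
  rw [hzero, sub_zero] at hlip
  have hKc : 0 ≤ Kc := le_trans (norm_nonneg _) (hG.norm_iteratedFDeriv_le (0 : Momentum) 0 (by norm_num))
  have hlow : -(Kc * ε / 2) ≤ frameLevel μ K M := by
    have h1 := (abs_le.1 hlip).1
    have h2 : Kc * ‖M - levelPoint μ K 0 χ‖ ≤ Kc * (ε / 2) := mul_le_mul_of_nonneg_left hMQ hKc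
    linarith
  -- combine
  have hcomb : (-μ - A - |ρ|) / (6 * π ^ 2) * ‖levelPoint μ K 0 θ - levelPoint μ K ρ (ϑ + θ)‖ ^ 2 ≤ 2 * A + |ρ| + Kc * ε / 2 := by
    linarith
  have hπ2 : 0 < 6 * π ^ 2 := by positivity
  rw [le_div_iff₀ hgap]
  have := mul_le_mul_of_nonneg_left hcomb hπ2.le
  calc ‖levelPoint μ K 0 θ - levelPoint μ K ρ (ϑ + θ)‖ ^ 2 * (-μ - A - |ρ|)
      = 6 * π ^ 2 * ((-μ - A - |ρ|) / (6 * π ^ 2) * ‖levelPoint μ K 0 θ - levelPoint μ K ρ (ϑ + θ)‖ ^ 2) := by field_simp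
    _ ≤ 6 * π ^ 2 * (2 * A + |ρ| + Kc * ε / 2) := this

omit hA20 hd hr hA₃ hA₄ in
/-- **The leg angle from the chord**: `(2u_min/π)·‖ϑ‖_𝕋 ≤ ‖Φ(0,θ) − Φ(ρ,ϑ+θ)‖` (part 1's lower chord bound at levels `0`, `ρ`). -/
theorem torusDist_le_norm_chord {ρ : ℝ} (hρ : |ρ| < r) (ϑ θ : ℝ) :
    2 * (bandBounds (show (-4 : ℝ) < -1.1 by norm_num) (show (-1.1 : ℝ) ≤ -0.1 by norm_num) (show (-0.1 : ℝ) < 0 by norm_num)).umin / π *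
        torusDist ϑ ≤ ‖levelPoint μ K 0 θ - levelPoint μ K ρ (ϑ + θ)‖ := by
  set B := bandBounds (show (-4 : ℝ) < -1.1 by norm_num) (show (-1.1 : ℝ) ≤ -0.1 by norm_num) (show (-0.1 : ℝ) < 0 by norm_num) with hBdef
  have hr' : 0 < r := lt_of_le_of_lt (abs_nonneg ρ) hρ
  have hlo₀ : (-1.1 : ℝ) ≤ μ + 0 - A := by linarith
  have hhi₀ : μ + 0 + A ≤ -0.1 := by linarith
  have hloρ : (-1.1 : ℝ) ≤ μ + ρ - A := by have := (abs_lt.1 hρ).1; linarith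
  have hhiρ : μ + ρ + A ≤ -0.1 := by have := (abs_lt.1 hρ).2; linarith
  have h := norm_levelPoint_sub_ge_torusDist B hA hlo₀ hhi₀ hloρ hhiρ θ (ϑ + θ)
  rwa [show θ - (ϑ + θ) = -ϑ by ring, torusDist_neg'] at h

omit hA20 hd hA₃ hA₄ in
/-- **The loop angle from the midpoint**: if `‖S − 2Φ(0,χ)‖ ≤ ε` then `(2u_min/π)·‖χ − θ‖_𝕋 ≤ ε/2 + ‖Φ(0,θ) − Φ(ρ,ϑ+θ)‖/2` (the loop point is within `ε/2` of the
midpoint, which is within half a chord of `Φ(0,θ)`). -/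
theorem torusDist_loopAngle_le_of_midpoint_near {ρ : ℝ} (hρ : |ρ| < r) {ϑ θ χ ε : ℝ}
    (hε : ‖pairSumPath μ K ρ ϑ θ 0 - (2 : ℝ) • levelPoint μ K 0 χ‖ ≤ ε) :
    2 * (bandBounds (show (-4 : ℝ) < -1.1 by norm_num) (show (-1.1 : ℝ) ≤ -0.1 by norm_num) (show (-0.1 : ℝ) < 0 by norm_num)).umin / π *
        torusDist (χ - θ) ≤ ε / 2 + ‖levelPoint μ K 0 θ - levelPoint μ K ρ (ϑ + θ)‖ / 2 := by
  set B := bandBounds (show (-4 : ℝ) < -1.1 by norm_num) (show (-1.1 : ℝ) ≤ -0.1 by norm_num) (show (-0.1 : ℝ) < 0 by norm_num) with hBdef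
  have hr' : 0 < r := lt_of_le_of_lt (abs_nonneg ρ) hρ
  have hlo₀ : (-1.1 : ℝ) ≤ μ + 0 - A := by linarith
  have hhi₀ : μ + 0 + A ≤ -0.1 := by linarith
  have hch := norm_levelPoint_sub_ge_torusDist B hA hlo₀ hhi₀ hlo₀ hhi₀ χ θ
  have hS : pairSumPath μ K ρ ϑ θ 0 = levelPoint μ K 0 θ + levelPoint μ K ρ (ϑ + θ) := by simp only [pairSumPath, add_zero]
  -- `Φ(0,χ) − Φ(0,θ) = −½(S − 2Φ(0,χ)) + ½(Φ(ρ,ϑ+θ) − Φ(0,θ))`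
  have e : levelPoint μ K 0 χ - levelPoint μ K 0 θ =
      -((1 / 2 : ℝ) • (pairSumPath μ K ρ ϑ θ 0 - (2 : ℝ) • levelPoint μ K 0 χ)) +
        (1 / 2 : ℝ) • (levelPoint μ K ρ (ϑ + θ) - levelPoint μ K 0 θ) := by
    rw [hS]; module
  have h1 : ‖levelPoint μ K 0 χ - levelPoint μ K 0 θ‖ ≤ ε / 2 + ‖levelPoint μ K 0 θ - levelPoint μ K ρ (ϑ + θ)‖ / 2 := by
    rw [e]
    refine (norm_add_le _ _).trans (add_le_add ?_ ?_)
    · rw [norm_neg, norm_smul, Real.norm_eq_abs, abs_of_pos (by norm_num : (0 : ℝ) < 1 / 2)]; linarith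
    · rw [norm_smul, Real.norm_eq_abs, abs_of_pos (by norm_num : (0 : ℝ) < 1 / 2), norm_sub_rev]; linarith
  exact hch.trans h1

end Sizes

end Summit.HubbardSuperconductivity.HubbardSuperconductivity.Theorems.C4a

end
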